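import Summits.CriticalPhenomena.PercolationContinuityZ3.Theorems.PercNearOneGluingNoHeavyLowerTailBlockThm4Localized
import Summits.CriticalPhenomena.PercolationContinuityZ3.Theorems.PercNearOneGluingAdditiveGluingBasePeel
import HarnessLib

/-!
# `NoHeavyLowerTail` (stmt-CriticalPhenomena-4575) — WEAKEST-PORT PEELING: Kozma–Nitzan's Theorem 4 with free ports,
# a two-sided recursion for the pre-FKG functional of a one-layer observer

Support file (lemma factory `prim-lf-3` gen 6, seat g7; `--supports stmt-CriticalPhenomena-4575`).  No definitions, no named
facts, no sorries.  Memo: `run/shared/lean/prim/prim-lf-3/LF3-Q9LP.md` §8.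

Setting (`Fin n`, weights `w`, `μ_w = prodBernoulli w`): `o ∉ A` a ONE-LAYER observer (every positive pair at `o` goes to `A`),
`b ∈ A`, and a port `v ∈ A` of `o` that is WEAKEST OFF `o`: `μ_K(v ↔ b) ≤ μ_K(p ↔ b)` for every port `p ≠ v`, where `K` is `w` with
the pairs at `o` zeroed.  For ANY vertex `a ∉ {o, v}` put `T_a(u) := μ_u(o ↔ b) − μ_u(a ↔ b, o ↔ A)` (Kozma–Nitzan's (41)/(2)
functional: `T_a(w) ≥ 0` says that `a` is a pre-FKG witness for `o`) and let `w⁻` be `w` with the pair `s(o,v)` deleted.  Then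

  `weakestPort_peel`:   `w(o,v) · [μ_w(v ↔ b) − μ_w(a ↔ b)] + (1 − w(o,v)) · T_a(w⁻) ≤ T_a(w)`.

No relation between `a` and the ports is assumed: the recursion is two-sided (it bounds the DEFICIT of a non-witness as well).
Iterating it along the ports in increasing `K`-order gives the weakest-first decision-list bound of the memo (§8); when all other
ports dominate `a` off `o`, `T_a(w⁻) ≥ 0` by Theorem 4 and one gets `T_a(w) ≥ w(o,v)·[μ_w(v↔b) − μ_w(a↔b)]`, a quantitative,
hypothesis-free form of Theorem 4 whose right side is a product of expectations over two independent copies of the port coins.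

Proof.  Condition on the pair `e = s(o,v)`: `μ_w(X) = (1 − w e)·μ_{w⁻}(X) + (w e)·μ_{w⁺}(X)` (`w⁺` = `e` glued); both `T_a` and
`h(u) := μ_u(v↔b) − μ_u(a↔b)` split affinely and `T_a(w⁺) = h(w⁺)` (`o ≡ v` under `w⁺`), whence the identity
`T_a(w) − (w e)·h(w) − (1 − w e)·T_a(w⁻) = (w e)(1 − w e)·[h(w⁺) − h(w⁻)]`; and `h(w⁺) − h(w⁻) = gain_v − gain_a ≥
μ_{w⁻}(o↔b, v↮b, a↮v) − μ_{w⁻}(v↔b, o↮b, a↔o) ≥ 0` (push-forward `ω ↦ ω ∪ {e}`, `glueSet_pushforward`; three-relay exchange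
`BlockQ9.blockThreeRelayExchange` with the block `{o}` in `w⁻`).
-/

namespace Summit.CriticalPhenomena.PercolationContinuityZ3.Theorems

open MeasureTheory Set ProbabilityTheory
open Literature.Probability.LatticeModels
open Literature.Probability.Percolation

noncomputable section
open Classical

namespace WeakestPort

variable {n : ℕ}

/-- Reachability after adding ONE pair `s(x,y)`: a walk in `ω ∪ {s(x,y)}` from `u` to `t` either avoids the new pair or splits at it.
[folklore] -/
theorem reachable_union_pair {ω : BondConfig (Fin n)} {x y u t : Fin n}
    (h : (openGraph ((ω ∪ {s(x, y)} : Set (Sym2 (Fin n))) : BondConfig (Fin n))).Reachable u t) :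
    (openGraph ω).Reachable u t ∨ ((openGraph ω).Reachable u x ∧ (openGraph ω).Reachable y t) ∨
      ((openGraph ω).Reachable u y ∧ (openGraph ω).Reachable x t) := by
  obtain ⟨p⟩ := h
  suffices key : ∀ (c d : Fin n) (q : (openGraph ((ω ∪ {s(x, y)} : Set (Sym2 (Fin n))) : BondConfig (Fin n))).Walk c d),
      (openGraph ω).Reachable c d ∨ ((openGraph ω).Reachable c x ∧ (openGraph ω).Reachable y d) ∨
        ((openGraph ω).Reachable c y ∧ (openGraph ω).Reachable x d) from key u t p
  intro c d q
  induction q with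
  | nil => exact Or.inl (SimpleGraph.Reachable.refl _)
  | cons hadj q ih =>
    rename_i c' m d'
    obtain ⟨hmem, hne⟩ := (openGraph_adj _ c' m).1 hadj
    rcases hmem with hω | hnew
    · have hcm : (openGraph ω).Reachable c' m := ((openGraph_adj ω c' m).2 ⟨hω, hne⟩).reachable
      rcases ih with h1 | ⟨h2, h3⟩ | ⟨h2, h3⟩
      · exact Or.inl (hcm.trans h1)
      · exact Or.inr (Or.inl ⟨hcm.trans h2, h3⟩)
      · exact Or.inr (Or.inr ⟨hcm.trans h2, h3⟩)
    · rw [mem_singleton_iff, Sym2.eq_iff] at hnew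
      rcases hnew with ⟨hc, hm⟩ | ⟨hc, hm⟩
      · subst hc; subst hm
        rcases ih with h1 | ⟨h2, h3⟩ | ⟨-, h3⟩
        · exact Or.inr (Or.inl ⟨SimpleGraph.Reachable.refl _, h1⟩)
        · exact Or.inl (h2.symm.trans h3)
        · exact Or.inl h3
      · subst hc; subst hm
        rcases ih with h1 | ⟨-, h3⟩ | ⟨h2, h3⟩
        · exact Or.inr (Or.inr ⟨SimpleGraph.Reachable.refl _, h1⟩)
        · exact Or.inl h3
        · exact Or.inl (h2.symm.trans h3)

/-- Converse direction: reachability is monotone under adding pairs, and the new pair joins its endpoints. [folklore] -/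
theorem reachable_union_pair_of {ω : BondConfig (Fin n)} {x y u t : Fin n} (hxy : x ≠ y)
    (h : (openGraph ω).Reachable u t ∨ ((openGraph ω).Reachable u x ∧ (openGraph ω).Reachable y t) ∨
      ((openGraph ω).Reachable u y ∧ (openGraph ω).Reachable x t)) :
    (openGraph ((ω ∪ {s(x, y)} : Set (Sym2 (Fin n))) : BondConfig (Fin n))).Reachable u t := by
  have hmono : ∀ {c d : Fin n}, (openGraph ω).Reachable c d →
      (openGraph ((ω ∪ {s(x, y)} : Set (Sym2 (Fin n))) : BondConfig (Fin n))).Reachable c d :=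
    fun h => h.mono (openGraph_mono subset_union_left)
  have hxy' : (openGraph ((ω ∪ {s(x, y)} : Set (Sym2 (Fin n))) : BondConfig (Fin n))).Reachable x y :=
    ((openGraph_adj _ x y).2 ⟨Or.inr (mem_singleton _), hxy⟩).reachable
  rcases h with h1 | ⟨h2, h3⟩ | ⟨h2, h3⟩
  · exact hmono h1
  · exact ((hmono h2).trans hxy').trans (hmono h3)
  · exact ((hmono h2).trans hxy'.symm).trans (hmono h3)

/-- Splitting a probability along one coordinate `e`: `μ_w(X) = (1 − w e)·μ_{w⁻}(X) + (w e)·μ_{w⁺}(X)`, `w⁻`/`w⁺` = `w` with `e`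
deleted / glued. [folklore; Grimmett 1999 §1.3] -/
theorem real_split_pair (w : Sym2 (Fin n) → unitInterval) (e : Sym2 (Fin n)) (X : Set (BondConfig (Fin n))) :
    (prodBernoulli w).real X =
      (1 - (w e : ℝ)) * (prodBernoulli (fun f => if f = e then 0 else w f)).real X +
        (w e : ℝ) * (prodBernoulli (fun f => if f = e then 1 else w f)).real X := by
  classical
  have hsplit := measureReal_inter_add_sdiff (μ := prodBernoulli w) (s := X)
    (MeasurableSet.of_discrete : MeasurableSet {ω : BondConfig (Fin n) | e ∈ ω}) (measure_ne_top _ _)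
  have hclosed : (prodBernoulli w).real (X \ {ω | e ∈ ω}) =
      (1 - (w e : ℝ)) * (prodBernoulli (fun f => if f = e then 0 else w f)).real X := by
    have : X \ {ω : BondConfig (Fin n) | e ∈ ω} = X ∩ {ω | e ∉ ω} := by ext ω; simp [mem_sdiff]
    rw [this]
    exact BlockQ9.real_inter_notMem_eq w _ e (by simp) (fun f hf => by simp [hf]) X
  have hopen : (prodBernoulli w).real (X ∩ {ω | e ∈ ω}) =
      (w e : ℝ) * (prodBernoulli (fun f => if f = e then 1 else w f)).real X := by
    have hco : {ω : BondConfig (Fin n) | e ∈ ω} = {ω | (↑({e} : Finset (Sym2 (Fin n))) : Set (Sym2 (Fin n))) ⊆ ω} := by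
      ext ω; simp
    have hw : (fun f : Sym2 (Fin n) => if f ∈ ({e} : Finset (Sym2 (Fin n))) then (1 : unitInterval) else w f) =
        fun f => if f = e then 1 else w f := by
      funext f; simp
    rw [hco, gluingLemma5_real_inter_allOpen w {e} MeasurableSet.of_discrete, prodBernoulli_real_subset, hw,
      Finset.prod_singleton]
  rw [← hsplit, hclosed, hopen]
  ring

/-- **Weakest-port peeling.**  See the module docstring. [cite: KozmaNitzan2024, Thm. 4, Lemma 5, Lemma 3(i), Question 9
(pp. 6, 12–14, 36); VandenbergHaggstromKahn2005, Thm. 1.2] -/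
theorem weakestPort_peel (w : Sym2 (Fin n) → unitInterval) (A : Finset (Fin n)) (o b a v : Fin n)
    (hoA : o ∉ A) (hvA : v ∈ A) (hbA : b ∈ A) (hao : a ≠ o) (hav : a ≠ v)
    (hiso : ∀ u, u ≠ o → u ∉ A → w s(o, u) = 0)
    (hweak : ∀ p ∈ A, p ≠ v → w s(o, p) ≠ 0 →
      (prodBernoulli (fun e : Sym2 (Fin n) => if (∃ x ∈ e, x ∈ ({o} : Finset (Fin n))) then 0 else w e)).real
          (openConn v b) ≤
        (prodBernoulli (fun e : Sym2 (Fin n) => if (∃ x ∈ e, x ∈ ({o} : Finset (Fin n))) then 0 else w e)).real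
          (openConn p b)) :
    (w s(o, v) : ℝ) * ((prodBernoulli w).real (openConn v b) - (prodBernoulli w).real (openConn a b)) +
      (1 - (w s(o, v) : ℝ)) *
        ((prodBernoulli (fun f => if f = s(o, v) then 0 else w f)).real (openConn o b) -
          (prodBernoulli (fun f => if f = s(o, v) then 0 else w f)).real (openConn a b ∩ ⋃ x ∈ A, openConn o x)) ≤
      (prodBernoulli w).real (openConn o b) - (prodBernoulli w).real (openConn a b ∩ ⋃ x ∈ A, openConn o x) := by
  classical
  set e : Sym2 (Fin n) := s(o, v) with he
  set wm : Sym2 (Fin n) → unitInterval := fun f => if f = e then 0 else w f with hwm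
  set wp : Sym2 (Fin n) → unitInterval := fun f => if f = e then 1 else w f with hwp
  set p : ℝ := (w e : ℝ) with hp
  set U : Set (BondConfig (Fin n)) := ⋃ x ∈ A, openConn o x with hU
  have hvo : v ≠ o := fun h => hoA (h ▸ hvA)
  have hbo : b ≠ o := fun h => hoA (h ▸ hbA)
  have hp0 : 0 ≤ p := (w e).2.1
  have hp1 : p ≤ 1 := (w e).2.2
  -- (1) split the four `w`-probabilities along `e`
  have s1 := real_split_pair w e (openConn o b)
  have s2 := real_split_pair w e (openConn a b ∩ U)
  have s3 := real_split_pair w e (openConn v b)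
  have s4 := real_split_pair w e (openConn a b)
  -- (2) `wp` is the push-forward of `wm` (and of `w`) under `ω ↦ ω ∪ {e}`
  have hpush : ∀ X : Set (BondConfig (Fin n)), (prodBernoulli wp).real X =
      (prodBernoulli wm).real {ω | ((ω ∪ {e} : Set (Sym2 (Fin n))) : BondConfig (Fin n)) ∈ X} := by
    intro X
    exact glueSet_pushforward wm wp {e} (fun f hf => by rw [mem_singleton_iff.1 hf]; simp [hwp])
      (fun f hf => by
        have hf' : f ≠ e := fun h => hf (h ▸ mem_singleton _)
        simp [hwp, hwm, hf']) X
  -- (3) the events after gluing `e`, read in `wm`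
  have hvb : {ω : BondConfig (Fin n) | ((ω ∪ {e} : Set (Sym2 (Fin n))) : BondConfig (Fin n)) ∈ (openConn v b : Set _)} =
      openConn v b ∪ openConn o b := by
    ext ω
    simp only [mem_setOf_eq, mem_union]
    constructor
    · intro h
      rcases reachable_union_pair (x := o) (y := v) (h : (openGraph _).Reachable v b) with h1 | ⟨-, h3⟩ | ⟨-, h3⟩
      · exact Or.inl h1
      · exact Or.inl h3
      · exact Or.inr h3
    · rintro (h | h)
      · exact reachable_union_pair_of hvo.symm (Or.inl h)
      · exact reachable_union_pair_of hvo.symm (Or.inr (Or.inr ⟨SimpleGraph.Reachable.refl _, h⟩))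
  have hob : {ω : BondConfig (Fin n) | ((ω ∪ {e} : Set (Sym2 (Fin n))) : BondConfig (Fin n)) ∈ (openConn o b : Set _)} =
      openConn v b ∪ openConn o b := by
    ext ω
    simp only [mem_setOf_eq, mem_union]
    constructor
    · intro h
      rcases reachable_union_pair (x := o) (y := v) (h : (openGraph _).Reachable o b) with h1 | ⟨-, h3⟩ | ⟨-, h3⟩
      · exact Or.inr h1
      · exact Or.inl h3
      · exact Or.inr h3
    · rintro (h | h)
      · exact reachable_union_pair_of hvo.symm (Or.inr (Or.inl ⟨SimpleGraph.Reachable.refl _, h⟩))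
      · exact reachable_union_pair_of hvo.symm (Or.inl h)
  have hab : {ω : BondConfig (Fin n) | ((ω ∪ {e} : Set (Sym2 (Fin n))) : BondConfig (Fin n)) ∈ (openConn a b : Set _)} =
      openConn a b ∪ (openConn a o ∩ openConn v b) ∪ (openConn a v ∩ openConn o b) := by
    ext ω
    simp only [mem_setOf_eq, mem_union, mem_inter_iff]
    constructor
    · intro h
      rcases reachable_union_pair (x := o) (y := v) (h : (openGraph _).Reachable a b) with h1 | ⟨h2, h3⟩ | ⟨h2, h3⟩
      · exact Or.inl (Or.inl h1)
      · exact Or.inl (Or.inr ⟨h2, h3⟩)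
      · exact Or.inr ⟨h2, h3⟩
    · rintro ((h | ⟨h2, h3⟩) | ⟨h2, h3⟩)
      · exact reachable_union_pair_of hvo.symm (Or.inl h)
      · exact reachable_union_pair_of hvo.symm (Or.inr (Or.inl ⟨h2, h3⟩))
      · exact reachable_union_pair_of hvo.symm (Or.inr (Or.inr ⟨h2, h3⟩))
  have habU : {ω : BondConfig (Fin n) | ((ω ∪ {e} : Set (Sym2 (Fin n))) : BondConfig (Fin n)) ∈ (openConn a b ∩ U : Set _)} =
      {ω : BondConfig (Fin n) | ((ω ∪ {e} : Set (Sym2 (Fin n))) : BondConfig (Fin n)) ∈ (openConn a b : Set _)} := by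
    ext ω
    simp only [mem_setOf_eq, mem_inter_iff, and_iff_left_iff_imp]
    intro _
    rw [hU]
    refine mem_iUnion₂.2 ⟨v, hvA, ?_⟩
    exact ((openGraph_adj _ o v).2 ⟨Or.inr (mem_singleton _), hvo.symm⟩).reachable
  -- (4) so `T_a(wp) = h(wp)` and both equal `μ_wm(v↔b ∪ o↔b) − μ_wm(a↔b ∪ …)`
  have e1 : (prodBernoulli wp).real (openConn o b) = (prodBernoulli wm).real (openConn v b ∪ openConn o b) := by
    rw [hpush, hob]
  have e3 : (prodBernoulli wp).real (openConn v b) = (prodBernoulli wm).real (openConn v b ∪ openConn o b) := by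
    rw [hpush, hvb]
  have e2 : (prodBernoulli wp).real (openConn a b ∩ U) =
      (prodBernoulli wm).real (openConn a b ∪ (openConn a o ∩ openConn v b) ∪ (openConn a v ∩ openConn o b)) := by
    rw [hpush, habU, hab]
  have e4 : (prodBernoulli wp).real (openConn a b) =
      (prodBernoulli wm).real (openConn a b ∪ (openConn a o ∩ openConn v b) ∪ (openConn a v ∩ openConn o b)) := by
    rw [hpush, hab]
  -- (5) the exchange: gain_v − gain_a ≥ 0 in `wm`
  have hgainv : (prodBernoulli wm).real (openConn v b ∪ openConn o b) - (prodBernoulli wm).real (openConn v b) =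
      (prodBernoulli wm).real (openConn o b ∩ (openConn v b)ᶜ) := by
    have := measureReal_union_add_inter (μ := prodBernoulli wm) (s := openConn o b)
      (MeasurableSet.of_discrete : MeasurableSet (openConn v b : Set (BondConfig (Fin n))))
    have h2 := measureReal_inter_add_sdiff (μ := prodBernoulli wm) (s := openConn o b)
      (MeasurableSet.of_discrete : MeasurableSet (openConn v b : Set (BondConfig (Fin n)))) (measure_ne_top _ _)
    have h3 : (openConn o b : Set (BondConfig (Fin n))) \ openConn v b = openConn o b ∩ (openConn v b)ᶜ := by
      ext ω; simp [mem_sdiff]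
    rw [union_comm] at this
    rw [h3] at h2
    linarith
  have hgaina : (prodBernoulli wm).real (openConn a b ∪ (openConn a o ∩ openConn v b) ∪ (openConn a v ∩ openConn o b)) -
      (prodBernoulli wm).real (openConn a b) ≤
      (prodBernoulli wm).real ((openConn a o ∩ openConn v b) ∩ (openConn a b)ᶜ) +
        (prodBernoulli wm).real ((openConn a v ∩ openConn o b) ∩ (openConn a b)ᶜ) := by
    have hsub : (openConn a b ∪ (openConn a o ∩ openConn v b) ∪ (openConn a v ∩ openConn o b) : Set (BondConfig (Fin n))) ⊆
        openConn a b ∪ (((openConn a o ∩ openConn v b) ∩ (openConn a b)ᶜ) ∪ ((openConn a v ∩ openConn o b) ∩ (openConn a b)ᶜ)) := by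
      intro ω hω
      by_cases h : ω ∈ (openConn a b : Set (BondConfig (Fin n)))
      · exact Or.inl h
      · rcases hω with (h1 | h2) | h3
        · exact Or.inl h1
        · exact Or.inr (Or.inl ⟨h2, h⟩)
        · exact Or.inr (Or.inr ⟨h3, h⟩)
    have m1 := measureReal_mono hsub (measure_ne_top (prodBernoulli wm) _)
    have m2 := measureReal_union_le (μ := prodBernoulli wm) (openConn a b : Set (BondConfig (Fin n)))
      (((openConn a o ∩ openConn v b) ∩ (openConn a b)ᶜ) ∪ ((openConn a v ∩ openConn o b) ∩ (openConn a b)ᶜ))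
    have m3 := measureReal_union_le (μ := prodBernoulli wm) ((openConn a o ∩ openConn v b) ∩ (openConn a b)ᶜ : Set (BondConfig (Fin n)))
      ((openConn a v ∩ openConn o b) ∩ (openConn a b)ᶜ)
    linarith
  -- the first error term is inside `{o ↔ b, v ↮ b}` minus `{a ↮ v}`-part; the second is the exchange's left side
  have hE1 : (prodBernoulli wm).real (openConn o b ∩ (openConn v b)ᶜ) -
      (prodBernoulli wm).real ((openConn a v ∩ openConn o b) ∩ (openConn a b)ᶜ) =
      (prodBernoulli wm).real (openConn o b ∩ (openConn v b)ᶜ ∩ (openConn a v)ᶜ) := by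
    have h2 := measureReal_inter_add_sdiff (μ := prodBernoulli wm) (s := openConn o b ∩ (openConn v b)ᶜ)
      (MeasurableSet.of_discrete : MeasurableSet (openConn a v : Set (BondConfig (Fin n)))) (measure_ne_top _ _)
    have hA : (openConn o b ∩ (openConn v b)ᶜ : Set (BondConfig (Fin n))) ∩ openConn a v =
        (openConn a v ∩ openConn o b) ∩ (openConn a b)ᶜ := by
      ext ω
      simp only [mem_inter_iff, mem_compl_iff]
      constructor
      · rintro ⟨⟨hob', hvb'⟩, hav'⟩
        refine ⟨⟨hav', hob'⟩, fun hab' => hvb' ?_⟩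
        exact (hav' : (openGraph ω).Reachable a v).symm.trans hab'
      · rintro ⟨⟨hav', hob'⟩, hab'⟩
        refine ⟨⟨hob', fun hvb' => hab' ?_⟩, hav'⟩
        exact (hav' : (openGraph ω).Reachable a v).trans hvb'
    have hB : (openConn o b ∩ (openConn v b)ᶜ : Set (BondConfig (Fin n))) \ openConn a v =
        openConn o b ∩ (openConn v b)ᶜ ∩ (openConn a v)ᶜ := by
      ext ω; simp [mem_sdiff, mem_inter_iff]
    rw [hA, hB] at h2
    linarith
  have hE2 : (prodBernoulli wm).real ((openConn a o ∩ openConn v b) ∩ (openConn a b)ᶜ) =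
      (prodBernoulli wm).real (openConn v b ∩ (⋃ o' ∈ ({o} : Finset (Fin n)), openConn o' b)ᶜ ∩
        ⋃ o' ∈ ({o} : Finset (Fin n)), openConn o' a) := by
    congr 1
    ext ω
    simp only [Finset.mem_singleton, iUnion_iUnion_eq_left, mem_inter_iff, mem_compl_iff]
    constructor
    · rintro ⟨⟨hao', hvb'⟩, hab'⟩
      refine ⟨⟨hvb', fun hob' => hab' ?_⟩, (hao' : (openGraph ω).Reachable a o).symm⟩
      exact (hao' : (openGraph ω).Reachable a o).trans hob'
    · rintro ⟨⟨hvb', hob'⟩, hoa'⟩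
      refine ⟨⟨(hoa' : (openGraph ω).Reachable o a).symm, hvb'⟩, fun hab' => hob' ?_⟩
      exact (hoa' : (openGraph ω).Reachable o a).trans hab'
  -- the three-relay exchange for the block `{o}` in `wm`
  have hglue : (fun f : Sym2 (Fin n) => if (∀ x ∈ f, x ∈ ({o} : Finset (Fin n))) ∧ ¬ f.IsDiag then (1 : unitInterval) else wm f) = wm := by
    funext f
    by_cases hf : (∀ x ∈ f, x ∈ ({o} : Finset (Fin n))) ∧ ¬ f.IsDiag
    · exfalso
      obtain ⟨h1, h2⟩ := hf
      induction f using Sym2.ind with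
      | h x y =>
        have hx := Finset.mem_singleton.1 (h1 x (Sym2.mem_mk_left x y))
        have hy := Finset.mem_singleton.1 (h1 y (Sym2.mem_mk_right x y))
        exact h2 (by rw [Sym2.mk_isDiag_iff, hx, hy])
    · simp only [if_neg hf]
  have hkill : (fun f : Sym2 (Fin n) => if (∃ x ∈ f, x ∈ ({o} : Finset (Fin n))) then (0 : unitInterval) else wm f) =
      fun f : Sym2 (Fin n) => if (∃ x ∈ f, x ∈ ({o} : Finset (Fin n))) then 0 else w f := by
    funext f
    by_cases hf : ∃ x ∈ f, x ∈ ({o} : Finset (Fin n))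
    · simp only [if_pos hf]
    · simp only [if_neg hf, hwm]
      have : f ≠ e := by
        rintro rfl
        exact hf ⟨o, Sym2.mem_mk_left o v, Finset.mem_singleton_self o⟩
      simp only [if_neg this]
  have hex := BlockQ9.blockThreeRelayExchange wm ({o} : Finset (Fin n)) A v b a
    (by simpa using hvo) (by simpa using hbo) (by simpa using hao)
    (by
      intro x hx y hyO hyA
      rw [Finset.mem_singleton] at hx; subst hx
      have hyo : y ≠ x := fun h => hyO (by simp [h])
      simp only [hwm]
      split_ifs
      · rfl
      · exact hiso y hyo hyA)
    (by
      intro q hq hport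
      obtain ⟨x, hx, hwx⟩ := hport
      rw [Finset.mem_singleton] at hx; subst hx
      have hne : s(x, q) ≠ e := fun h => by apply hwx; simp only [hwm, if_pos h]
      have hqv : q ≠ v := by rintro rfl; exact hne rfl
      have hwq : w s(x, q) ≠ 0 := by simpa only [hwm, if_neg hne] using hwx
      rw [hkill]
      exact hweak q hq hqv hwq)
  rw [hglue] at hex
  simp only [Finset.mem_singleton, iUnion_iUnion_eq_left] at hex hE2
  -- (6) assemble
  rw [s1, s2, s3, s4, e1, e2, e3, e4]
  have key : (prodBernoulli wm).real (openConn a b ∪ (openConn a o ∩ openConn v b) ∪ (openConn a v ∩ openConn o b)) -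
      (prodBernoulli wm).real (openConn a b) ≤
      (prodBernoulli wm).real (openConn v b ∪ openConn o b) - (prodBernoulli wm).real (openConn v b) := by
    rw [hgainv]
    have := hE2
    linarith [hgaina, hE1, hex, measureReal_nonneg (μ := prodBernoulli wm)
      (s := openConn o b ∩ (openConn v b)ᶜ ∩ (openConn a v)ᶜ)]
  have hpp : 0 ≤ p * (1 - p) := mul_nonneg hp0 (by linarith)
  nlinarith [key, hpp, mul_le_mul_of_nonneg_left key hpp]

/-- **Corollary (Theorem 4 with one free port).**  If `a` is a pre-FKG witness for the REDUCED observer (pair `s(o,v)` deleted;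
e.g. by Kozma–Nitzan's Theorem 4 when the other ports dominate `a` off `o`), then
`w(o,v)·[μ_w(v ↔ b) − μ_w(a ↔ b)] ≤ μ_w(o ↔ b) − μ_w(a ↔ b, o ↔ A)`: a two-sided bound, hypothesis-free in `a` versus `v`.
[cite: KozmaNitzan2024, Thm. 4 (pp. 12–14), Question 9 (p. 36)] -/
theorem weakestPort_peel_of_reduced (w : Sym2 (Fin n) → unitInterval) (A : Finset (Fin n)) (o b a v : Fin n)
    (hoA : o ∉ A) (hvA : v ∈ A) (hbA : b ∈ A) (hao : a ≠ o) (hav : a ≠ v)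
    (hiso : ∀ u, u ≠ o → u ∉ A → w s(o, u) = 0)
    (hweak : ∀ p ∈ A, p ≠ v → w s(o, p) ≠ 0 →
      (prodBernoulli (fun e : Sym2 (Fin n) => if (∃ x ∈ e, x ∈ ({o} : Finset (Fin n))) then 0 else w e)).real
          (openConn v b) ≤
        (prodBernoulli (fun e : Sym2 (Fin n) => if (∃ x ∈ e, x ∈ ({o} : Finset (Fin n))) then 0 else w e)).real
          (openConn p b))
    (hred : (prodBernoulli (fun f => if f = s(o, v) then 0 else w f)).real (openConn a b ∩ ⋃ x ∈ A, openConn o x) ≤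
      (prodBernoulli (fun f => if f = s(o, v) then 0 else w f)).real (openConn o b)) :
    (w s(o, v) : ℝ) * ((prodBernoulli w).real (openConn v b) - (prodBernoulli w).real (openConn a b)) ≤
      (prodBernoulli w).real (openConn o b) - (prodBernoulli w).real (openConn a b ∩ ⋃ x ∈ A, openConn o x) := by
  have h := weakestPort_peel w A o b a v hoA hvA hbA hao hav hiso hweak
  have h1 : 0 ≤ 1 - (w s(o, v) : ℝ) := sub_nonneg.2 (w s(o, v)).2.2
  nlinarith [mul_nonneg h1 (sub_nonneg.2 hred)]

/-- **Corollary (mixed-domination witness).**  If moreover `μ_w(a ↔ b) ≤ μ_w(v ↔ b)` (the free port dominates `a` in the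
FULL graph), then `a` is a pre-FKG witness for `o`: `μ_w(a ↔ b, o ↔ A) ≤ μ_w(o ↔ b)`.
[cite: KozmaNitzan2024, inequality (2) (p. 3), Thm. 4 (p. 12), Question 9 (p. 36)] -/
theorem preFKG_of_reduced_of_freePort (w : Sym2 (Fin n) → unitInterval) (A : Finset (Fin n)) (o b a v : Fin n)
    (hoA : o ∉ A) (hvA : v ∈ A) (hbA : b ∈ A) (hao : a ≠ o) (hav : a ≠ v)
    (hiso : ∀ u, u ≠ o → u ∉ A → w s(o, u) = 0)
    (hweak : ∀ p ∈ A, p ≠ v → w s(o, p) ≠ 0 →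
      (prodBernoulli (fun e : Sym2 (Fin n) => if (∃ x ∈ e, x ∈ ({o} : Finset (Fin n))) then 0 else w e)).real
          (openConn v b) ≤
        (prodBernoulli (fun e : Sym2 (Fin n) => if (∃ x ∈ e, x ∈ ({o} : Finset (Fin n))) then 0 else w e)).real
          (openConn p b))
    (hred : (prodBernoulli (fun f => if f = s(o, v) then 0 else w f)).real (openConn a b ∩ ⋃ x ∈ A, openConn o x) ≤
      (prodBernoulli (fun f => if f = s(o, v) then 0 else w f)).real (openConn o b))
    (hdomG : (prodBernoulli w).real (openConn a b) ≤ (prodBernoulli w).real (openConn v b)) :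
    (prodBernoulli w).real (openConn a b ∩ ⋃ x ∈ A, openConn o x) ≤ (prodBernoulli w).real (openConn o b) := by
  have h := weakestPort_peel_of_reduced w A o b a v hoA hvA hbA hao hav hiso hweak hred
  nlinarith [mul_nonneg (w s(o, v)).2.1 (sub_nonneg.2 hdomG)]

end WeakestPort

end

end Summit.CriticalPhenomena.PercolationContinuityZ3.Theorems
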